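import Summits.CriticalPhenomena.PercolationContinuityZ3.Theorems.SahiMasterFamilyZeroFlagMinorF
import Summits.CriticalPhenomena.PercolationContinuityZ3.Theorems.PercNearOneGluingNoHeavyLowerTailSahiCombMasterFamily
import Summits.CriticalPhenomena.PercolationContinuityZ3.Theorems.PercNearOneGluingNoHeavyLowerTailSahiCombDisjunctThreeIdentities

/-!
# The `F`-inequality tensorizes over coordinates the third event ignores; `F ≥ 0` when the third event is a single coordinate

Unit `prim-master-conj` (crux anchor stmt-CriticalPhenomena-4575, helper work), gen 21; memo
`run/shared/lean/prim/prim-l12/prim-master-conj/POINTWISE.md` §22.  Companion of gen 20's `…ZeroFlagMinorF`.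

Recall (gen 20, memo §21) the conjectured inequality, for increasing events `A, B, G` and a product measure `μ`,
  `F(A,B;G) := (1 + μG)·μ(A∩B∩G) − μG·μ(A∩B) − μ(A∩G)·μ(B∩G) ≥ 0`,
which implies `MD_3` on the D0 core (`sahiE_three_ge_sq_minor_of_F_nonneg`).  This file proves the first structural facts about `F` itself:

* `fIneq_eq_sections_of_free` — **exact one-coordinate recursion when `G` is `e`-free**: with `X^b = X^{e←b}` and `p = p_e`,
  `F(A,B;G) = (1−p)·F(A⁰,B⁰;G) + p·F(A¹,B¹;G) + p(1−p)·[μ(A¹∩G) − μ(A⁰∩G)]·[μ(B¹∩G) − μ(B⁰∩G)]` (any events `A, B`; pure algebra from conditioning on `e`).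
* `fIneq_ge_sections_of_free` — for increasing `A, B` the last product is `≥ 0`, so **`F(A,B;G) ≥ (1−p)·F(A⁰,B⁰;G) + p·F(A¹,B¹;G)`**; hence
  `fIneq_nonneg_of_free_of_sections`: `F ≥ 0` for `(A,B,G)` as soon as it holds for the two section pairs `(A^{e←b}, B^{e←b})` with the same `G`.
  CONSEQUENCE (memo §22.1, the "junta reduction"): `F ≥ 0` for all increasing `A, B` whenever it holds for all increasing pairs living on the coordinates `G`
  depends on — so, with the exhaustive Bernstein census of `F` on `{0,1}^k, k ≤ 6` (prim-bnk-2 g18, kit j145952; gen 20, j145057), `F ≥ 0` for every `G` determined by at most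
  six coordinates, in any dimension (paper-proved, computer-assisted; not a kernel fact here).
* `fIneq_nonneg_of_coordinate` — **`F(A,B;G) ≥ 0` for all increasing `A, B` when `G = {ω | e ∈ ω}` is a single-coordinate event** (conditioning on `e`:
  `F = p·[(1−p)·(μ(A¹B¹) − μ(A⁰B⁰)) + p·(μ(A¹B¹) − μA¹·μB¹)]`, sections nested + Harris on the `1`-sections).
* `sahiE_three_ge_sq_minor_of_third_coordinate` — the D0-core consequence: `MD_3` at `(U,e)` holds unconditionally when the (`e`-free) third member `U_2`
  is a single-coordinate event `{ω | e' ∈ ω}`.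
HONEST FRAMING: elementary identities/inequalities; `F ≥ 0` in general remains OPEN (memo §22: transport-lemma programme). [this work]
-/

noncomputable section

open scoped Classical

namespace Summit.CriticalPhenomena.PercolationContinuityZ3.Theorems

open Finset Function
open Literature.Combinatorics.Sahi2008
open Literature.Probability.Percolation.DecisionTree (ind)

namespace Pointwise

variable {ι : Type} [Fintype ι]

/-! ### 1. Conditioning `F` on a coordinate that `G` ignores -/

section Free

variable (p : ι → unitInterval) (e : ι) (A B G : Set (Set ι)) (hG : secAt e true G = secAt e false G)
include hG

/-- **Exact recursion of `F` along a coordinate `e` that `G` ignores** (file header): writing `X^b = X^{e←b}`, `p = p_e`, `G' = G^{e←0} = G^{e←1}`,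
`F(A,B;G) = (1−p)·F(A⁰,B⁰;G') + p·F(A¹,B¹;G') + p(1−p)·(μ(A¹∩G') − μ(A⁰∩G'))·(μ(B¹∩G') − μ(B⁰∩G'))`.  Any events `A, B`; pure algebra. [this work] -/
theorem fIneq_eq_sections_of_free :
    (1 + ex (bernoulliWeight p) (ind G)) * ex (bernoulliWeight p) (ind (A ∩ B ∩ G))
        - ex (bernoulliWeight p) (ind G) * ex (bernoulliWeight p) (ind (A ∩ B))
        - ex (bernoulliWeight p) (ind (A ∩ G)) * ex (bernoulliWeight p) (ind (B ∩ G))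
      = (1 - (p e : ℝ)) *
          ((1 + ex (bernoulliWeight p) (ind (secAt e false G)))
              * ex (bernoulliWeight p) (ind (secAt e false A ∩ secAt e false B ∩ secAt e false G))
            - ex (bernoulliWeight p) (ind (secAt e false G)) * ex (bernoulliWeight p) (ind (secAt e false A ∩ secAt e false B))
            - ex (bernoulliWeight p) (ind (secAt e false A ∩ secAt e false G))
              * ex (bernoulliWeight p) (ind (secAt e false B ∩ secAt e false G)))
        + (p e : ℝ) *
          ((1 + ex (bernoulliWeight p) (ind (secAt e false G)))
              * ex (bernoulliWeight p) (ind (secAt e true A ∩ secAt e true B ∩ secAt e false G))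
            - ex (bernoulliWeight p) (ind (secAt e false G)) * ex (bernoulliWeight p) (ind (secAt e true A ∩ secAt e true B))
            - ex (bernoulliWeight p) (ind (secAt e true A ∩ secAt e false G))
              * ex (bernoulliWeight p) (ind (secAt e true B ∩ secAt e false G)))
        + (p e : ℝ) * (1 - (p e : ℝ)) *
          ((ex (bernoulliWeight p) (ind (secAt e true A ∩ secAt e false G)) - ex (bernoulliWeight p) (ind (secAt e false A ∩ secAt e false G)))
            * (ex (bernoulliWeight p) (ind (secAt e true B ∩ secAt e false G)) - ex (bernoulliWeight p) (ind (secAt e false B ∩ secAt e false G)))) := by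
  have hG' : ex (bernoulliWeight p) (ind G) = ex (bernoulliWeight p) (ind (secAt e false G)) := by
    rw [ex_ind_eq_secAt p e G, hG]; ring
  have hABG := ex_ind_eq_secAt p e (A ∩ B ∩ G)
  have hAB := ex_ind_eq_secAt p e (A ∩ B)
  have hAG := ex_ind_eq_secAt p e (A ∩ G)
  have hBG := ex_ind_eq_secAt p e (B ∩ G)
  simp only [secAt_inter, hG] at hABG hAB hAG hBG
  rw [hG', hABG, hAB, hAG, hBG]
  ring

/-- **`F(A,B;G) ≥ (1−p_e)·F(A⁰,B⁰;G') + p_e·F(A¹,B¹;G')` for increasing `A, B` and `e`-free `G`** — the cross term of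
`fIneq_eq_sections_of_free` is `p(1−p)·ν·ν' ≥ 0` because the sections of increasing events are nested. [this work] -/
theorem fIneq_ge_sections_of_free (hA : IsUpperSet A) (hB : IsUpperSet B) :
    (1 - (p e : ℝ)) *
          ((1 + ex (bernoulliWeight p) (ind (secAt e false G)))
              * ex (bernoulliWeight p) (ind (secAt e false A ∩ secAt e false B ∩ secAt e false G))
            - ex (bernoulliWeight p) (ind (secAt e false G)) * ex (bernoulliWeight p) (ind (secAt e false A ∩ secAt e false B))
            - ex (bernoulliWeight p) (ind (secAt e false A ∩ secAt e false G))
              * ex (bernoulliWeight p) (ind (secAt e false B ∩ secAt e false G)))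
        + (p e : ℝ) *
          ((1 + ex (bernoulliWeight p) (ind (secAt e false G)))
              * ex (bernoulliWeight p) (ind (secAt e true A ∩ secAt e true B ∩ secAt e false G))
            - ex (bernoulliWeight p) (ind (secAt e false G)) * ex (bernoulliWeight p) (ind (secAt e true A ∩ secAt e true B))
            - ex (bernoulliWeight p) (ind (secAt e true A ∩ secAt e false G))
              * ex (bernoulliWeight p) (ind (secAt e true B ∩ secAt e false G)))
      ≤ (1 + ex (bernoulliWeight p) (ind G)) * ex (bernoulliWeight p) (ind (A ∩ B ∩ G))
        - ex (bernoulliWeight p) (ind G) * ex (bernoulliWeight p) (ind (A ∩ B))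
        - ex (bernoulliWeight p) (ind (A ∩ G)) * ex (bernoulliWeight p) (ind (B ∩ G)) := by
  rw [fIneq_eq_sections_of_free p e A B G hG]
  have hp0 : 0 ≤ (p e : ℝ) := (p e).2.1
  have hp1 : 0 ≤ 1 - (p e : ℝ) := sub_nonneg.2 (p e).2.2
  have sA : secAt e false A ∩ secAt e false G ⊆ secAt e true A ∩ secAt e false G :=
    Set.inter_subset_inter_left _ (RigidityAll.secAt_false_subset_secAt_true e hA)
  have sB : secAt e false B ∩ secAt e false G ⊆ secAt e true B ∩ secAt e false G :=
    Set.inter_subset_inter_left _ (RigidityAll.secAt_false_subset_secAt_true e hB)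
  have tA : 0 ≤ ex (bernoulliWeight p) (ind (secAt e true A ∩ secAt e false G))
      - ex (bernoulliWeight p) (ind (secAt e false A ∩ secAt e false G)) := by
    rw [ex_ind_sub_of_subset _ sA]; exact ex_ind_nonneg' p _
  have tB : 0 ≤ ex (bernoulliWeight p) (ind (secAt e true B ∩ secAt e false G))
      - ex (bernoulliWeight p) (ind (secAt e false B ∩ secAt e false G)) := by
    rw [ex_ind_sub_of_subset _ sB]; exact ex_ind_nonneg' p _
  nlinarith [mul_nonneg (mul_nonneg hp0 hp1) (mul_nonneg tA tB)]

/-- **Junta reduction, one step**: for increasing `A, B` and `e`-free `G`, if `F ≥ 0` holds for both section pairs `(A^{e←0},B^{e←0})`,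
`(A^{e←1},B^{e←1})` (with the common third event `G' = G^{e←0}`), then `F(A,B;G) ≥ 0`. Iterating over all coordinates that `G` ignores reduces
`F ≥ 0` to pairs living on the coordinates `G` depends on (memo §22.1). [this work] -/
theorem fIneq_nonneg_of_free_of_sections (hA : IsUpperSet A) (hB : IsUpperSet B)
    (h0 : 0 ≤ (1 + ex (bernoulliWeight p) (ind (secAt e false G)))
              * ex (bernoulliWeight p) (ind (secAt e false A ∩ secAt e false B ∩ secAt e false G))
            - ex (bernoulliWeight p) (ind (secAt e false G)) * ex (bernoulliWeight p) (ind (secAt e false A ∩ secAt e false B))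
            - ex (bernoulliWeight p) (ind (secAt e false A ∩ secAt e false G))
              * ex (bernoulliWeight p) (ind (secAt e false B ∩ secAt e false G)))
    (h1 : 0 ≤ (1 + ex (bernoulliWeight p) (ind (secAt e false G)))
              * ex (bernoulliWeight p) (ind (secAt e true A ∩ secAt e true B ∩ secAt e false G))
            - ex (bernoulliWeight p) (ind (secAt e false G)) * ex (bernoulliWeight p) (ind (secAt e true A ∩ secAt e true B))
            - ex (bernoulliWeight p) (ind (secAt e true A ∩ secAt e false G))
              * ex (bernoulliWeight p) (ind (secAt e true B ∩ secAt e false G))) :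
    0 ≤ (1 + ex (bernoulliWeight p) (ind G)) * ex (bernoulliWeight p) (ind (A ∩ B ∩ G))
        - ex (bernoulliWeight p) (ind G) * ex (bernoulliWeight p) (ind (A ∩ B))
        - ex (bernoulliWeight p) (ind (A ∩ G)) * ex (bernoulliWeight p) (ind (B ∩ G)) := by
  have h := fIneq_ge_sections_of_free p e A B G hG hA hB
  have hp0 : 0 ≤ (p e : ℝ) := (p e).2.1
  have hp1 : 0 ≤ 1 - (p e : ℝ) := sub_nonneg.2 (p e).2.2
  nlinarith [mul_nonneg hp1 h0, mul_nonneg hp0 h1]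

end Free

/-! ### 2. `F ≥ 0` when the third event is a single coordinate -/

/-- **`F(A,B;G) ≥ 0` for all increasing `A, B` when `G = {ω | e ∈ ω}` is a single-coordinate event.**  Conditioning on `e`:
`F = p_e·[(1−p_e)·(μ(A¹∩B¹) − μ(A⁰∩B⁰)) + p_e·(μ(A¹∩B¹) − μ(A¹)μ(B¹))] ≥ 0` (nested sections; Harris on the `1`-sections). [this work] -/
theorem fIneq_nonneg_of_coordinate (p : ι → unitInterval) (e : ι) {A B : Set (Set ι)} (hA : IsUpperSet A) (hB : IsUpperSet B) :
    0 ≤ (1 + ex (bernoulliWeight p) (ind {ω : Set ι | e ∈ ω})) * ex (bernoulliWeight p) (ind (A ∩ B ∩ {ω : Set ι | e ∈ ω}))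
        - ex (bernoulliWeight p) (ind {ω : Set ι | e ∈ ω}) * ex (bernoulliWeight p) (ind (A ∩ B))
        - ex (bernoulliWeight p) (ind (A ∩ {ω : Set ι | e ∈ ω})) * ex (bernoulliWeight p) (ind (B ∩ {ω : Set ι | e ∈ ω})) := by
  have hG1 : secAt e true {ω : Set ι | e ∈ ω} = Set.univ := SahiCombDisjunct.secAt_true_coord e
  have hG0 : secAt e false {ω : Set ι | e ∈ ω} = ∅ := SahiCombDisjunct.secAt_false_coord e
  have h1 : ex (bernoulliWeight p) (ind (Set.univ : Set (Set ι))) = 1 := by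
    rw [ind_univ_eq_one]; exact ex_one (sum_bernoulliWeight p)
  have hGm : ex (bernoulliWeight p) (ind {ω : Set ι | e ∈ ω}) = (p e : ℝ) := by
    rw [ex_ind_eq_secAt p e {ω : Set ι | e ∈ ω}, hG1, hG0, h1, ex_ind_empty]; ring
  have hABG : ex (bernoulliWeight p) (ind (A ∩ B ∩ {ω : Set ι | e ∈ ω}))
      = (p e : ℝ) * ex (bernoulliWeight p) (ind (secAt e true A ∩ secAt e true B)) := by
    rw [ex_ind_eq_secAt p e (A ∩ B ∩ {ω : Set ι | e ∈ ω})]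
    simp only [secAt_inter, hG1, hG0, Set.inter_univ, Set.inter_empty, ex_ind_empty]
    ring
  have hAG : ex (bernoulliWeight p) (ind (A ∩ {ω : Set ι | e ∈ ω})) = (p e : ℝ) * ex (bernoulliWeight p) (ind (secAt e true A)) := by
    rw [ex_ind_eq_secAt p e (A ∩ {ω : Set ι | e ∈ ω})]
    simp only [secAt_inter, hG1, hG0, Set.inter_univ, Set.inter_empty, ex_ind_empty]
    ring
  have hBG : ex (bernoulliWeight p) (ind (B ∩ {ω : Set ι | e ∈ ω})) = (p e : ℝ) * ex (bernoulliWeight p) (ind (secAt e true B)) := by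
    rw [ex_ind_eq_secAt p e (B ∩ {ω : Set ι | e ∈ ω})]
    simp only [secAt_inter, hG1, hG0, Set.inter_univ, Set.inter_empty, ex_ind_empty]
    ring
  have hAB : ex (bernoulliWeight p) (ind (A ∩ B))
      = (p e : ℝ) * ex (bernoulliWeight p) (ind (secAt e true A ∩ secAt e true B))
        + (1 - (p e : ℝ)) * ex (bernoulliWeight p) (ind (secAt e false A ∩ secAt e false B)) := by
    rw [ex_ind_eq_secAt p e (A ∩ B)]
    simp only [secAt_inter]
  rw [hGm, hABG, hAG, hBG, hAB]
  have hp0 : 0 ≤ (p e : ℝ) := (p e).2.1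
  have hp1 : 0 ≤ 1 - (p e : ℝ) := sub_nonneg.2 (p e).2.2
  -- nested sections: `A⁰ ∩ B⁰ ⊆ A¹ ∩ B¹`
  have sAB : secAt e false A ∩ secAt e false B ⊆ secAt e true A ∩ secAt e true B :=
    Set.inter_subset_inter (RigidityAll.secAt_false_subset_secAt_true e hA) (RigidityAll.secAt_false_subset_secAt_true e hB)
  have tAB : 0 ≤ ex (bernoulliWeight p) (ind (secAt e true A ∩ secAt e true B))
      - ex (bernoulliWeight p) (ind (secAt e false A ∩ secAt e false B)) := by
    rw [ex_ind_sub_of_subset _ sAB]; exact ex_ind_nonneg' p _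
  -- Harris on the `1`-sections
  have tH : 0 ≤ ex (bernoulliWeight p) (ind (secAt e true A ∩ secAt e true B))
      - ex (bernoulliWeight p) (ind (secAt e true A)) * ex (bernoulliWeight p) (ind (secAt e true B)) :=
    cov_ind_nonneg p (isUpperSet_secAt e true hA) (isUpperSet_secAt e true hB)
  have key : (1 + (p e : ℝ)) * ((p e : ℝ) * ex (bernoulliWeight p) (ind (secAt e true A ∩ secAt e true B)))
        - (p e : ℝ) * ((p e : ℝ) * ex (bernoulliWeight p) (ind (secAt e true A ∩ secAt e true B))
            + (1 - (p e : ℝ)) * ex (bernoulliWeight p) (ind (secAt e false A ∩ secAt e false B)))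
        - (p e : ℝ) * ex (bernoulliWeight p) (ind (secAt e true A)) * ((p e : ℝ) * ex (bernoulliWeight p) (ind (secAt e true B)))
      = (p e : ℝ) * ((1 - (p e : ℝ)) * (ex (bernoulliWeight p) (ind (secAt e true A ∩ secAt e true B))
            - ex (bernoulliWeight p) (ind (secAt e false A ∩ secAt e false B)))
          + (p e : ℝ) * (ex (bernoulliWeight p) (ind (secAt e true A ∩ secAt e true B))
            - ex (bernoulliWeight p) (ind (secAt e true A)) * ex (bernoulliWeight p) (ind (secAt e true B)))) := by
    ring
  rw [key]
  exact mul_nonneg hp0 (add_nonneg (mul_nonneg hp1 tAB) (mul_nonneg hp0 tH))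

/-! ### 3. The D0-core consequence -/

/-- **MD_3 on the D0 core when the third member is a single coordinate.**  Under the hypotheses of `sahiE_three_ge_sq_minor_of_F_nonneg`
(increasing triple `U`, `e`-free third member with `0`-minor `(X,Y,G)` a zero flag with trivial hull), if `G = U_2^{e←0} = {ω | e' ∈ ω}` then
`(1−p_e)²E_3(U^{e←0}) + p_e²E_3(U^{e←1}) ≤ E_3(U)` unconditionally. [this work] -/
theorem sahiE_three_ge_sq_minor_of_third_coordinate (p : ι → unitInterval) (e e' : ι) (U : Fin 3 → Set (Set ι))
    (hU : ∀ j, IsUpperSet (U j)) (hG : secAt e true (U 2) = secAt e false (U 2))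
    (hXG : secAt e false (U 0) ⊆ secAt e false (U 2)) (hYG : secAt e false (U 1) ⊆ secAt e false (U 2))
    (hXY : ex (bernoulliWeight p) (ind (secAt e false (U 0) ∩ secAt e false (U 1)))
      = ex (bernoulliWeight p) (ind (secAt e false (U 0))) * ex (bernoulliWeight p) (ind (secAt e false (U 1))))
    (hcoord : secAt e false (U 2) = {ω : Set ι | e' ∈ ω}) :
    (1 - (p e : ℝ)) ^ 2 * sahiE (bernoulliWeight p) 3 (fun j => ind (secAt e false (U j)))
      + (p e : ℝ) ^ 2 * sahiE (bernoulliWeight p) 3 (fun j => ind (secAt e true (U j)))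
      ≤ sahiE (bernoulliWeight p) 3 (fun j => ind (U j)) := by
  refine sahiE_three_ge_sq_minor_of_F_nonneg p e U hU hG hXG hYG hXY ?_
  rw [hcoord]
  exact fIneq_nonneg_of_coordinate p e' (isUpperSet_secAt e true (hU 0)) (isUpperSet_secAt e true (hU 1))

end Pointwise

end Summit.CriticalPhenomena.PercolationContinuityZ3.Theorems
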